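import Mathlib

/-!
# Hodge locus census — V3-XT, N = 1: the 3-INERT census relative to `j = 1728` and Nekovář's weight-3/2 coefficient for `D < 0` (engine A, abs-1 gen 26, ROW 5)

HONEST FRAMING: certified instances and evidence bearing on the general Hodge conjecture; no claim.

Setting: `M ≡ 1 (mod 12)` squarefree, `K = ℚ(√-M)` (discriminant `-4M`), so `3` is INERT in `K`; every CM curve of
discriminant `-4M f²` (`f = 1, 2`) reduces at a prime over `3` to the supersingular curve `j = 0 = 1728`, and the census of
`data/abs/xt/n1inert/` (kit jobs listed in `code/abs_engineA/xt/n1inert/DERIVATION-N8-A.md`) records, for every class `C`,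
`v₃(j(C)) = 3` (no variation) but `v₃(j(C) - 1728) ∈ {6, 8, 10, 12, …}`.  Put `ν₈(D) := #{C ∈ Cl(D) : v₃(j(C) - 1728) ≥ 8}`
(`= #{C : j(C) ≡ 1728 (mod 3⁸)}`).  THEOREM N8⁻ of the derivation file: with `c(-M) := [q^M] η(6z)η(18z)θ(3z)` (Nekovář's `F₋`,
[Nekovar1990, Prop. 6.4]),

  (G)   `η(6z)η(18z) = ½(θ_{[1,0,27]} - θ_{[4,2,7]})`  (weight 1, level 108, `χ₋₃`; PROVED by a finite check to the Sturm bound 18 —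
        in print as the cubic-residuacity theta series [Hiramatsu–Saito, p. 8]), hence identically
        `c(-M) = ½ ( r(M; x² + 27y² + 3z²) - r(M; 4x² + 2xy + 7y² + 3z²) )`;
  (D8)  DICTIONARY (certified against the two-implementation census for all squarefree `M ≡ 1 (12)`, `M ≤ 2·10⁴`):
        `r(M; x² + 27y² + 3z²) = 4 ν₈(-4M)`,  `r(M; 4x² + 2xy + 7y² + 3z²) = 2 ν₈(-16M)`,  `ν₈(-4M) + ν₈(-16M) = h(-4M)`
        (and Gauss: `r(M; x² + y² + z²) = 12 h(-4M)`);
  (N8⁻) therefore `c(-M) = 2ν₈(-4M) - ν₈(-16M) = 3ν₈(-4M) - h(-4M) = h(-16M) - 3ν₈(-16M)`, refining Nekovář's congruence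
        `c(D) ≡ -h(D) (mod 3)` for `D < 0` [Nekovar1990, Prop. 7.2] to an exact identity; and by [Nekovar1990, Thm. 6.6]
        `L(E⁽⁻ᴹ⁾, 1) = ω₁ · (3ν₈(-4M) - h(-4M))²` for the quadratic twist `E⁽⁻ᴹ⁾` of `X₀(27)` (`27a1`), so
        `L(E⁽⁻ᴹ⁾, 1) = 0 ⟺` exactly one third of the classes of discriminant `-4M` have `j ≡ 1728 (mod 3⁸)`
        (numerically certified for all 1 509 such `M ≤ 2·10⁴`).

Contents (the finite algebraic core; the modular inputs — Nekovář's theorems, the class-polynomial census — are NOT formalised):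
* `G_truncated` — identity (G) coefficientwise for `n ≤ 40` (beyond the Sturm bound `18`): twice the Hecke-character double sum
  `Σ (-1)^{m+k} [((6m+1)² + 3(6k+1)²) = 4n]` ([Hiramatsu–Saito, p. 8]'s expression of `η(6z)η(18z)`) equals
  `r(n; x² + 27y²) - r(n; 4x² + 2xy + 7y²)`, by `decide` over complete boxes;
* `sturm_numerals` — `[SL₂(ℤ) : Γ₀(108)] = 216`, weight-1 bound `216/12 = 18 < 41`, weight-3/2 bound `27`;
* `same_determinant` — the two ternary forms have Gram determinant `81` (one genus candidate);
* `anchor_13`, `anchor_85`, `anchor_109` — the ternary counts at `M = 13` (`h(-52) = 2`, `ν₈ = 1`: counts `4, 2`, `c = 1`),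
  `M = 85` (`h = 4`, `ν₈(-340) = 0`: count `0`, `c = -4`, `L ≠ 0`) and `M = 109` (`h = 6`, `ν₈ = 2 = h/3`: counts `8, 8`, `c = 0`,
  `L(E⁽⁻¹⁰⁹⁾,1) = 0`), plus Gauss `r₃(13) = 24 = 12·2`, by `decide +kernel` over complete boxes;
* `N8_assembly`, `nekovar_72_congruence`, `nonvanishing_criterion`, `L_ne_zero_of_not_three_dvd_h` — the arithmetic of THEOREM N8⁻:
  from `2c = r₁ - r₂`, `r₁ = 4ν`, `r₂ = 2ν'`, `ν + ν' = h` one gets the three closed forms, `3 ∣ c + h`, `A = c² ⇒ (A = 0 ↔ 3ν = h)`,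
  and `3 ∤ h ⇒ c ≠ 0`.

politeness: helper file, no `def`s, no new axioms, `lean check` rc 0, 0 sorries.
-/

namespace Summit.HodgeConjecture.HodgeConjecture.HodgeLocus.Census.Inert3At1728

/-! ### Identity (G) to beyond the Sturm bound -/

/-- (G) truncated at `q⁴⁰`: for every `n ≤ 40`, twice the `n`-th coefficient of Hiramatsu–Saito's double sum for `η(6z)η(18z)`
equals `r(n; x²+27y²) - r(n; 4x²+2xy+7y²)`.  Boxes are complete: `(6m+1)² ≤ 160 ⇒ m ∈ [-2,1]`, `3(6k+1)² ≤ 160 ⇒ k ∈ [-1,1]`;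
`x² + 27y² ≤ 40 ⇒ |x| ≤ 6, |y| ≤ 1`; `4x²+2xy+7y² = 3x² + (x+y)² + 6y² ≤ 40 ⇒ |x| ≤ 3, |y| ≤ 2`.  The Sturm bound for
`M₁(Γ₀(108), χ₋₃)` is `18` (`sturm_numerals`). [decide] -/
theorem G_truncated : ∀ n ∈ Finset.range 41,
    2 * ((Finset.Icc (-3 : ℤ) 3 ×ˢ Finset.Icc (-3 : ℤ) 3).sum
          (fun p => if (6 * p.1 + 1) ^ 2 + 3 * (6 * p.2 + 1) ^ 2 = 4 * (n : ℤ) then (-1 : ℤ) ^ (p.1 + p.2).natAbs else 0)) =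
      (((Finset.Icc (-7 : ℤ) 7 ×ˢ Finset.Icc (-7 : ℤ) 7).filter (fun p => p.1 ^ 2 + 27 * p.2 ^ 2 = (n : ℤ))).card : ℤ) -
      (((Finset.Icc (-7 : ℤ) 7 ×ˢ Finset.Icc (-7 : ℤ) 7).filter (fun p => 4 * p.1 ^ 2 + 2 * p.1 * p.2 + 7 * p.2 ^ 2 = (n : ℤ))).card : ℤ) := by
  decide +kernel

/-- Sturm bookkeeping: `[SL₂(ℤ) : Γ₀(108)] = 108 · (3/2) · (4/3) = 216`; weight `1`: `216 · 1 / 12 = 18` (and `18 < 41`, the range of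
`G_truncated`); weight `3/2` (for `F₋ = gθ(3z) ∈ S_{3/2}(Γ₀(108))`): `216 · (3/2) / 12 = 27`. [numerals] -/
theorem sturm_numerals : 108 * 3 * 4 = 216 * 2 * 3 ∧ 216 * 1 = 12 * 18 ∧ 18 < 41 ∧ 216 * 3 = 24 * 27 := by
  refine ⟨by norm_num, by norm_num, by norm_num, by norm_num⟩

/-- The two ternary forms `x² + 27y² + 3z²` and `4x² + 2xy + 7y² + 3z²` have the same Gram determinant `81`
(half-Gram for the binary part: `4·7 - 1·1 = 27`). [numerals] -/
theorem same_determinant : (1 : ℤ) * 27 * 3 = 81 ∧ ((4 : ℤ) * 7 - 1 * 1) * 3 = 81 := by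
  refine ⟨by norm_num, by norm_num⟩

/-! ### Anchors of the dictionary (D8) -/

/-- Anchor `M = 13` (`D = -52`, `h = 2`, census `ν₈(-52) = 1`, `ν₈(-208) = 1`): `r(13; x²+27y²+3z²) = 4 = 4·1`,
`r(13; 4x²+2xy+7y²+3z²) = 2 = 2·1`, hence `c(-13) = (4 - 2)/2 = 1 = 3·1 - 2`; and Gauss `r(13; x²+y²+z²) = 24 = 12·2`.
Boxes complete (`|x| ≤ 3 < 4`, `27y² ≤ 13 ⇒ y = 0`, `3z² ≤ 13 ⇒ |z| ≤ 2`; `3x² ≤ 13`). [decide] -/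
theorem anchor_13 :
    ((Finset.Icc (-4 : ℤ) 4 ×ˢ Finset.Icc (-1 : ℤ) 1 ×ˢ Finset.Icc (-2 : ℤ) 2).filter
        (fun p => p.1 ^ 2 + 27 * p.2.1 ^ 2 + 3 * p.2.2 ^ 2 = 13)).card = 4 ∧
    ((Finset.Icc (-4 : ℤ) 4 ×ˢ Finset.Icc (-2 : ℤ) 2 ×ˢ Finset.Icc (-2 : ℤ) 2).filter
        (fun p => 4 * p.1 ^ 2 + 2 * p.1 * p.2.1 + 7 * p.2.1 ^ 2 + 3 * p.2.2 ^ 2 = 13)).card = 2 ∧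
    ((Finset.Icc (-4 : ℤ) 4 ×ˢ Finset.Icc (-4 : ℤ) 4 ×ˢ Finset.Icc (-4 : ℤ) 4).filter
        (fun p => p.1 ^ 2 + p.2.1 ^ 2 + p.2.2 ^ 2 = 13)).card = 24 := by
  refine ⟨by decide +kernel, by decide +kernel, by decide +kernel⟩

/-- Anchor `M = 85` (`D = -340`, `h = 4`, census `ν₈(-340) = 0`): `x² + 27y² + 3z² = 85` has NO solution, so `c(-85) = -h = -4`
once `r(85; 4x²+2xy+7y²+3z²) = 8 = 2 ν₈(-1360)` (`ν₈(-1360) = 4`); `L(E⁽⁻⁸⁵⁾, 1) = 16 ω₁ ≠ 0`.  Boxes complete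
(`|x| ≤ 9`, `|y| ≤ 1`, `|z| ≤ 5`; `3x² ≤ 85 ⇒ |x| ≤ 5`, `6y² ≤ 85 ⇒ |y| ≤ 3`). [decide] -/
theorem anchor_85 :
    ((Finset.Icc (-10 : ℤ) 10 ×ˢ Finset.Icc (-1 : ℤ) 1 ×ˢ Finset.Icc (-5 : ℤ) 5).filter
        (fun p => p.1 ^ 2 + 27 * p.2.1 ^ 2 + 3 * p.2.2 ^ 2 = 85)).card = 0 ∧
    ((Finset.Icc (-5 : ℤ) 5 ×ˢ Finset.Icc (-4 : ℤ) 4 ×ˢ Finset.Icc (-5 : ℤ) 5).filter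
        (fun p => 4 * p.1 ^ 2 + 2 * p.1 * p.2.1 + 7 * p.2.1 ^ 2 + 3 * p.2.2 ^ 2 = 85)).card = 8 := by
  refine ⟨by decide +kernel, by decide +kernel⟩

/-- Anchor `M = 109` (`D = -436`, `h = 6`, census `ν₈(-436) = 2 = h/3`, `ν₈(-1744) = 4`): both ternary counts equal `8`, so
`c(-109) = 0` and `L(E⁽⁻¹⁰⁹⁾, 1) = 0` — the first vanishing twist in the family.  Boxes complete (`|x| ≤ 10`, `|y| ≤ 2`,
`|z| ≤ 6`; `|x| ≤ 6`, `|y| ≤ 4`). [decide] -/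
theorem anchor_109 :
    ((Finset.Icc (-11 : ℤ) 11 ×ˢ Finset.Icc (-2 : ℤ) 2 ×ˢ Finset.Icc (-6 : ℤ) 6).filter
        (fun p => p.1 ^ 2 + 27 * p.2.1 ^ 2 + 3 * p.2.2 ^ 2 = 109)).card = 8 ∧
    ((Finset.Icc (-6 : ℤ) 6 ×ˢ Finset.Icc (-4 : ℤ) 4 ×ˢ Finset.Icc (-6 : ℤ) 6).filter
        (fun p => 4 * p.1 ^ 2 + 2 * p.1 * p.2.1 + 7 * p.2.1 ^ 2 + 3 * p.2.2 ^ 2 = 109)).card = 8 := by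
  refine ⟨by decide +kernel, by decide +kernel⟩

/-- Completeness of the boxes used above: the binary part of the second form dominates `3x²` and `6y²`. [nlinarith] -/
theorem second_form_lower_bounds (x y : ℤ) :
    3 * x ^ 2 ≤ 4 * x ^ 2 + 2 * x * y + 7 * y ^ 2 ∧ 6 * y ^ 2 ≤ 4 * x ^ 2 + 2 * x * y + 7 * y ^ 2 := by
  constructor <;> nlinarith [sq_nonneg (x + y), sq_nonneg (2 * x + y), sq_nonneg y, sq_nonneg x, sq_nonneg (x + 2 * y), sq_nonneg (2*x + y)]

/-! ### The arithmetic of THEOREM N8⁻ -/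

/-- Assembly: from the coefficient identity `2c = r₁ - r₂` (a consequence of (G)), the dictionary `r₁ = 4ν`, `r₂ = 2ν'`
(`ν = ν₈(-4M)`, `ν' = ν₈(-16M)`) and the genus relation `ν + ν' = h` (`h = h(-4M)`, `h(-16M) = 2h`), Nekovář's coefficient is
`c = 2ν - ν' = 3ν - h = 2h - 3ν'`. [derived: THEOREM N8⁻] -/
theorem N8_assembly (c r₁ r₂ ν ν' h : ℤ) (hc : 2 * c = r₁ - r₂) (h₁ : r₁ = 4 * ν) (h₂ : r₂ = 2 * ν') (hg : ν + ν' = h) :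
    c = 2 * ν - ν' ∧ c = 3 * ν - h ∧ c = 2 * h - 3 * ν' := by
  refine ⟨by omega, by omega, by omega⟩

/-- Nekovář's congruence [Nekovar1990, Prop. 7.2] for `D = -M < 0`, `M ≡ 1, 5 (mod 8)`: `c(-M) ≡ -h(-4M) (mod 3)` — here an
immediate consequence of the exact formula `c = 3ν - h`. [derived] -/
theorem nekovar_72_congruence (c ν h : ℤ) (hc : c = 3 * ν - h) : 3 ∣ c + h := ⟨ν, by omega⟩

/-- Non-vanishing criterion: with `A := L(E⁽⁻ᴹ⁾,1)/ω₁ = c²` ([Nekovar1990, Thm. 6.6]; certified numerically for `M ≤ 2·10⁴`),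
`L(E⁽⁻ᴹ⁾, 1) = 0` iff exactly one third of the classes of discriminant `-4M` have `j ≡ 1728 (mod 3⁸)`. [derived] -/
theorem nonvanishing_criterion (A c ν h : ℤ) (hA : A = c ^ 2) (hc : c = 3 * ν - h) : A = 0 ↔ 3 * ν = h := by
  subst hA; subst hc
  constructor
  · intro h0; have := pow_eq_zero_iff (n := 2) (by norm_num) |>.mp h0; omega
  · intro h3; have : 3 * ν - h = 0 := by omega
    rw [this]; norm_num

/-- In particular `3 ∤ h(-4M)` forces `L(E⁽⁻ᴹ⁾, 1) ≠ 0` (e.g. `M = 13, 37, 73, 85, 97`: `h = 2, 2, 4, 4, 4`). [derived] -/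
theorem L_ne_zero_of_not_three_dvd_h (c ν h : ℤ) (hc : c = 3 * ν - h) (h3 : ¬ 3 ∣ h) : c ≠ 0 := by
  intro h0; apply h3; exact ⟨ν, by omega⟩

/-- The anchors are consistent with the assembly: `M = 13`: `2·1 = 4 - 2`, `1 = 3·1 - 2`; `M = 85`: `2·(-4) = 0 - 8`, `-4 = 3·0 - 4`;
`M = 109`: `2·0 = 8 - 8`, `0 = 3·2 - 6` and `3·2 = 6` (vanishing). [numerals] -/
theorem anchors_consistent :
    (2 : ℤ) * 1 = 4 - 2 ∧ (1 : ℤ) = 3 * 1 - 2 ∧ (2 : ℤ) * (-4) = 0 - 8 ∧ (-4 : ℤ) = 3 * 0 - 4 ∧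
    (2 : ℤ) * 0 = 8 - 8 ∧ (0 : ℤ) = 3 * 2 - 6 ∧ (3 : ℤ) * 2 = 6 := by
  refine ⟨by norm_num, by norm_num, by norm_num, by norm_num, by norm_num, by norm_num, by norm_num⟩

end Summit.HodgeConjecture.HodgeConjecture.HodgeLocus.Census.Inert3At1728
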